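import Mathlib.Analysis.Complex.JensenFormula
import Mathlib.Analysis.SpecialFunctions.Integrability.LogMeromorphic
import Mathlib.MeasureTheory.Integral.DominatedConvergence
import HarnessLib

/-!
# The sub-mean-value inequality for `log(|G|² + ε)` at the centre of a disc

Topic `Literature/Analysis/Complex`. For `G` analytic on a neighbourhood of a closed disc
`\overline{B}(c, R)` and `ε > 0`,
`log(|G(c)|² + ε) ≤ ⨍_{|z-c|=R} log(|G(z)|² + ε)` — the sub-mean-value property of the
subharmonic function `log(|G|² + ε)`, in the regularised form (no `log 0`) in which it enters
J. Bourgain, S. Dyatlov, *Spectral gaps without the pressure condition*, Ann. of Math. 187 (2018),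
§2.4 Lemma 2.12 / §3.2 (the harmonic-measure bound `log|F(t)| ≤ ∫ log|F| dμ_t`, used after an
explicit conformal map sends `t` to the centre). Proof: with `N = (|G(c)|²+ε)^{1/2}`,
`a = conj(G(c))/N`, `b = √ε/N` one has `aG(c) + b√ε = N` and, by Cauchy–Schwarz,
`|aG(z) + b√ε|² ≤ |G(z)|² + ε`; Jensen's formula (Mathlib, `AnalyticOnNhd.circleAverage_log_norm`)
for the analytic function `aG + b√ε`, whose zero-counting term is nonnegative, gives
`2 log N ≤ 2 ⨍ log|aG + b√ε| ≤ ⨍ log(|G|²+ε)`. All statements folklore.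

* `log_norm_le_circleAverage_log_norm` — `log|f(c)| ≤ ⨍ log|f|` for `f` analytic near the closed
  disc with `f(c) ≠ 0` (Jensen's inequality);
* `log_normSq_add_le_circleAverage` — the regularised inequality above;
* `log_normSq_add_le_circleAverage_unitDisc` — the same on the unit disc for `G` holomorphic
  inside, bounded, and continuous up to the circle away from a finite set (radii `ρ → 1`,
  dominated convergence); `countable_circleMap_preimage`;
* `log_normSq_add_le_average_radialLimit` — the same with a.e. radial boundary limits `g(θ)`
  (the form used with branch-cut-discontinuous boundary correspondences).
-/

namespace Literature.Analysis.Complex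

open _root_.Complex Metric Real MeasureTheory MeromorphicOn Filter
open scoped Topology

/-- **Jensen's inequality at the centre**: for `f` analytic on a neighbourhood of the closed disc
`\overline{B}(c,|R|)`, `R ≠ 0`, `f c ≠ 0`: `log ‖f c‖ ≤ ⨍ log ‖f‖` over the circle (the
zero-counting term of Jensen's formula is nonnegative). [folklore] -/
theorem log_norm_le_circleAverage_log_norm {f : ℂ → ℂ} {c : ℂ} {R : ℝ} (hR : R ≠ 0)
    (hf : AnalyticOnNhd ℂ f (closedBall c |R|)) (h0 : f c ≠ 0) :
    Real.log ‖f c‖ ≤ circleAverage (fun z => Real.log ‖f z‖) c R := by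
  rw [hf.circleAverage_log_norm hR h0]
  have hsum : 0 ≤ ∑ᶠ u, (MeromorphicOn.divisor f (closedBall c |R|) u : ℝ) *
      Real.log (R * ‖c - u‖⁻¹) := by
    apply finsum_nonneg
    intro u
    by_cases hu : u ∈ closedBall c |R|
    · by_cases huc : u = c
      · rw [huc, AnalyticOnNhd.divisor_apply hf (by simp),
          (hf c (by simp)).analyticOrderAt_eq_zero.mpr h0]
        simp
      · apply mul_nonneg (by exact_mod_cast AnalyticOnNhd.divisor_nonneg hf u)
        have hne : ‖c - u‖ ≠ 0 := by simpa [sub_eq_zero] using (Ne.symm huc)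
        have hpos : 0 < ‖c - u‖ := (norm_nonneg _).lt_of_ne' hne
        rw [mem_closedBall, dist_eq_norm'] at hu
        rw [← Real.log_abs, abs_mul, abs_inv, abs_norm]
        apply Real.log_nonneg
        rw [le_mul_inv_iff₀ hpos, one_mul]
        exact hu
    · simp [Function.locallyFinsuppWithin.apply_eq_zero_of_notMem _ hu]
  linarith

/-- Cauchy–Schwarz for two complex terms: `‖a x + b y‖² ≤ (‖a‖² + ‖b‖²)(‖x‖² + ‖y‖²)`.
[folklore] -/
theorem norm_sq_two_term_le (a b x y : ℂ) :
    ‖a * x + b * y‖ ^ 2 ≤ (‖a‖ ^ 2 + ‖b‖ ^ 2) * (‖x‖ ^ 2 + ‖y‖ ^ 2) := by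
  have h1 : ‖a * x + b * y‖ ≤ ‖a‖ * ‖x‖ + ‖b‖ * ‖y‖ := by
    calc ‖a * x + b * y‖ ≤ ‖a * x‖ + ‖b * y‖ := norm_add_le _ _
      _ = ‖a‖ * ‖x‖ + ‖b‖ * ‖y‖ := by rw [norm_mul, norm_mul]
  have h2 : (‖a‖ * ‖x‖ + ‖b‖ * ‖y‖) ^ 2 ≤ (‖a‖ ^ 2 + ‖b‖ ^ 2) * (‖x‖ ^ 2 + ‖y‖ ^ 2) := by
    nlinarith [sq_nonneg (‖a‖ * ‖y‖ - ‖b‖ * ‖x‖), norm_nonneg a, norm_nonneg b, norm_nonneg x,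
      norm_nonneg y]
  calc ‖a * x + b * y‖ ^ 2 ≤ (‖a‖ * ‖x‖ + ‖b‖ * ‖y‖) ^ 2 :=
        pow_le_pow_left₀ (norm_nonneg _) h1 2
    _ ≤ _ := h2

/-- The regularised sub-mean-value inequality when `ε ≥ 1` (so that `log(‖G‖² + ε) ≥ 0`, which
sidesteps `log 0 = 0` at possible zeros of the comparison function on the circle). [folklore] -/
theorem log_normSq_add_le_circleAverage_of_one_le {G : ℂ → ℂ} {c : ℂ} {R ε : ℝ} (hR : R ≠ 0)
    (hG : AnalyticOnNhd ℂ G (closedBall c |R|)) (hε : 1 ≤ ε) :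
    Real.log (‖G c‖ ^ 2 + ε) ≤ circleAverage (fun z => Real.log (‖G z‖ ^ 2 + ε)) c R := by
  have hε0 : 0 < ε := by linarith
  -- the comparison function `h = a G + b √ε` with `h c = N = (‖G c‖² + ε)^{1/2}`
  set N : ℝ := Real.sqrt (‖G c‖ ^ 2 + ε) with hN
  have hN0 : 0 < N := Real.sqrt_pos.2 (by positivity)
  have hNsq : N ^ 2 = ‖G c‖ ^ 2 + ε := Real.sq_sqrt (by positivity)
  set a : ℂ := (starRingEnd ℂ) (G c) / N with ha
  set b : ℂ := (Real.sqrt ε : ℂ) / N with hb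
  set h : ℂ → ℂ := fun z => a * G z + b * (Real.sqrt ε : ℂ) with hh
  have hh_an : AnalyticOnNhd ℂ h (closedBall c |R|) := fun z hz =>
    (analyticAt_const.mul (hG z hz)).add analyticAt_const
  have hab : ‖a‖ ^ 2 + ‖b‖ ^ 2 = 1 := by
    rw [ha, hb, norm_div, norm_div, Complex.norm_conj, Complex.norm_real, Complex.norm_real,
      Real.norm_of_nonneg hN0.le, Real.norm_of_nonneg (Real.sqrt_nonneg _), div_pow, div_pow,
      Real.sq_sqrt hε0.le, ← add_div, ← hNsq, div_self (by positivity)]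
  have hhc : h c = (N : ℂ) := by
    simp only [hh, ha, hb]
    rw [div_mul_eq_mul_div, div_mul_eq_mul_div, ← add_div, Complex.conj_mul' (G c)]
    rw [← Complex.ofReal_pow, ← Complex.ofReal_mul, Real.mul_self_sqrt hε0.le, ← Complex.ofReal_add,
      ← hNsq]
    push_cast
    field_simp
  have hhc_norm : ‖h c‖ = N := by rw [hhc, Complex.norm_real, Real.norm_of_nonneg hN0.le]
  have hhc_ne : h c ≠ 0 := by
    rw [hhc]; exact_mod_cast hN0.ne'
  -- Jensen for `h`
  have hJ := log_norm_le_circleAverage_log_norm hR hh_an hhc_ne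
  rw [hhc_norm] at hJ
  -- pointwise comparison on the circle
  have hpt : ∀ z ∈ sphere c |R|, Real.log ‖h z‖ ≤ (1 / 2 : ℝ) * Real.log (‖G z‖ ^ 2 + ε) := by
    intro z _
    have hcs : ‖h z‖ ^ 2 ≤ ‖G z‖ ^ 2 + ε := by
      have := norm_sq_two_term_le a b (G z) (Real.sqrt ε : ℂ)
      rw [hab, one_mul, Complex.norm_real, Real.norm_of_nonneg (Real.sqrt_nonneg _),
        Real.sq_sqrt hε0.le] at this
      exact this
    have hRHS : 0 ≤ Real.log (‖G z‖ ^ 2 + ε) := Real.log_nonneg (by nlinarith [norm_nonneg (G z)])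
    by_cases hz : h z = 0
    · rw [hz, norm_zero, Real.log_zero]; positivity
    · have hpos : 0 < ‖h z‖ := norm_pos_iff.2 hz
      have : Real.log (‖h z‖ ^ 2) ≤ Real.log (‖G z‖ ^ 2 + ε) :=
        Real.log_le_log (by positivity) hcs
      rw [Real.log_pow] at this
      push_cast at this
      linarith
  have hint1 : CircleIntegrable (fun z => Real.log ‖h z‖) c R :=
    MeromorphicOn.circleIntegrable_log_norm fun z hz =>
      (AnalyticOnNhd.meromorphicOn hh_an) z (sphere_subset_closedBall hz)
  have hcont : ContinuousOn (fun z => (1 / 2 : ℝ) * Real.log (‖G z‖ ^ 2 + ε)) (sphere c |R|) := by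
    apply ContinuousOn.mul continuousOn_const
    apply ContinuousOn.log
    · exact ((hG.continuousOn.mono sphere_subset_closedBall).norm.pow 2).add continuousOn_const
    · intro z _; nlinarith [norm_nonneg (G z)]
  have hint2 : CircleIntegrable (fun z => (1 / 2 : ℝ) * Real.log (‖G z‖ ^ 2 + ε)) c R :=
    hcont.circleIntegrable'
  have hmono := circleAverage_mono hint1 hint2 hpt
  have hsmul : circleAverage (fun z => (1 / 2 : ℝ) * Real.log (‖G z‖ ^ 2 + ε)) c R =
      (1 / 2 : ℝ) * circleAverage (fun z => Real.log (‖G z‖ ^ 2 + ε)) c R := by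
    rw [← smul_eq_mul, ← circleAverage_fun_smul]
    rfl
  rw [hsmul] at hmono
  have hlogN : Real.log (‖G c‖ ^ 2 + ε) = 2 * Real.log N := by
    rw [← hNsq, Real.log_pow]; push_cast; ring
  rw [hlogN]
  linarith

/-- **The sub-mean-value inequality for `log(|G|² + ε)` at the centre** (regularised
subharmonicity of `log|G|`): for `G` analytic on a neighbourhood of `\overline{B}(c,|R|)`, `R ≠ 0`
and `ε > 0`, `log(‖G c‖² + ε) ≤ ⨍_{|z-c|=|R|} log(‖G z‖² + ε)`. Reduced to `ε = 1` by the
scaling `G ↦ ε^{-1/2} G`. [folklore] -/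
theorem log_normSq_add_le_circleAverage {G : ℂ → ℂ} {c : ℂ} {R ε : ℝ} (hR : R ≠ 0)
    (hG : AnalyticOnNhd ℂ G (closedBall c |R|)) (hε : 0 < ε) :
    Real.log (‖G c‖ ^ 2 + ε) ≤ circleAverage (fun z => Real.log (‖G z‖ ^ 2 + ε)) c R := by
  set s : ℝ := (Real.sqrt ε)⁻¹ with hs
  have hsq : 0 < Real.sqrt ε := Real.sqrt_pos.2 hε
  have hs0 : 0 < s := by positivity
  have hs2 : s ^ 2 * ε = 1 := by
    rw [hs, inv_pow, Real.sq_sqrt hε.le, inv_mul_cancel₀ hε.ne']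
  set G' : ℂ → ℂ := fun z => (s : ℂ) * G z with hG'
  have hG'an : AnalyticOnNhd ℂ G' (closedBall c |R|) := fun z hz => analyticAt_const.mul (hG z hz)
  have hkey : ∀ z, Real.log (‖G' z‖ ^ 2 + 1) = Real.log (‖G z‖ ^ 2 + ε) - Real.log ε := by
    intro z
    have e1 : ‖G' z‖ ^ 2 + 1 = (‖G z‖ ^ 2 + ε) / ε := by
      simp only [hG', norm_mul, Complex.norm_real, Real.norm_of_nonneg hs0.le, mul_pow]
      field_simp
      nlinarith [hs2]
    rw [e1, Real.log_div (by nlinarith [norm_nonneg (G z)]) hε.ne']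
  have h1 := log_normSq_add_le_circleAverage_of_one_le hR hG'an le_rfl
  rw [hkey] at h1
  have hfun : (fun z => Real.log (‖G' z‖ ^ 2 + 1)) =
      fun z => Real.log (‖G z‖ ^ 2 + ε) - Real.log ε := funext hkey
  rw [hfun] at h1
  have hcontG : ContinuousOn (fun z => Real.log (‖G z‖ ^ 2 + ε)) (sphere c |R|) := by
    apply ContinuousOn.log
    · exact ((hG.continuousOn.mono sphere_subset_closedBall).norm.pow 2).add continuousOn_const
    · intro z _; nlinarith [norm_nonneg (G z)]
  have hsub : circleAverage (fun z => Real.log (‖G z‖ ^ 2 + ε) - Real.log ε) c R =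
      circleAverage (fun z => Real.log (‖G z‖ ^ 2 + ε)) c R - Real.log ε := by
    rw [circleAverage_fun_sub hcontG.circleIntegrable' (circleIntegrable_const _ _ _),
      circleAverage_const]
  rw [hsub] at h1
  linarith

/-- The set of angles at which the unit circle map hits a finite set is countable (indeed finite
modulo `2π`), hence Lebesgue-null. [folklore] -/
theorem countable_circleMap_preimage {E : Set ℂ} (hE : E.Finite) (c : ℂ) {R : ℝ} (hR : R ≠ 0) :
    {θ : ℝ | circleMap c R θ ∈ E}.Countable := by
  have : {θ : ℝ | circleMap c R θ ∈ E} ⊆ ⋃ e ∈ E, {θ : ℝ | circleMap c R θ = e} := by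
    intro θ hθ
    exact Set.mem_iUnion₂.2 ⟨_, hθ, rfl⟩
  refine Set.Countable.mono this (Set.Countable.biUnion hE.countable fun e _ => ?_)
  by_cases hne : {θ : ℝ | circleMap c R θ = e}.Nonempty
  · obtain ⟨θ₀, hθ₀⟩ := hne
    · have hsub : {θ : ℝ | circleMap c R θ = e} ⊆
          Set.range (fun n : ℤ => θ₀ + n * (2 * π)) := by
        intro θ hθ
        simp only [Set.mem_setOf_eq] at hθ hθ₀
        have h1 : Complex.exp (θ * Complex.I) = Complex.exp (θ₀ * Complex.I) := by
          have hR' : (R : ℂ) ≠ 0 := by exact_mod_cast hR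
          have := hθ.trans hθ₀.symm
          simp only [circleMap, add_right_inj] at this
          exact mul_left_cancel₀ hR' this
        obtain ⟨n, hn⟩ := Complex.exp_eq_exp_iff_exists_int.1 h1
        refine ⟨n, ?_⟩
        have h2 : (θ : ℂ) = θ₀ + n * (2 * π) := by
          have hI : Complex.I ≠ 0 := Complex.I_ne_zero
          have := hn
          rw [show (θ₀ : ℂ) * Complex.I + n * (2 * π * Complex.I) =
            ((θ₀ : ℂ) + n * (2 * π)) * Complex.I by ring] at this
          exact mul_right_cancel₀ hI this
        have h3 : θ = θ₀ + n * (2 * π) := by exact_mod_cast h2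
        exact h3.symm
      exact (Set.countable_range _).mono hsub
  · rw [Set.not_nonempty_iff_eq_empty.1 hne]
    exact Set.countable_empty

/-- **Sub-mean-value inequality for `log(|G|² + ε)` on the unit disc with boundary values**:
`G` holomorphic on the open unit disc, bounded by `M`, continuous on the closed disc away from a
finite set `E`; then `log(‖G 0‖² + ε) ≤ ⨍_{|z|=1} log(‖G z‖² + ε)` for `ε > 0` (from the closed-disc
version on radii `ρ < 1` and dominated convergence as `ρ → 1`). [folklore] -/
theorem log_normSq_add_le_circleAverage_unitDisc {G : ℂ → ℂ} {E : Set ℂ} {M ε : ℝ}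
    (hE : E.Finite) (hG : DifferentiableOn ℂ G (ball 0 1))
    (hcont : ContinuousOn G (closedBall 0 1 \ E)) (hM : ∀ z ∈ ball 0 1, ‖G z‖ ≤ M)
    (hε : 0 < ε) :
    Real.log (‖G 0‖ ^ 2 + ε) ≤ circleAverage (fun z => Real.log (‖G z‖ ^ 2 + ε)) 0 1 := by
  have hM0 : 0 ≤ M := (norm_nonneg _).trans (hM 0 (by simp))
  -- radii `ρ_n = 1 - 1/(n+2)`
  set ρ : ℕ → ℝ := fun n => 1 - 1 / ((n : ℝ) + 2) with hρdef
  have hρ0 : ∀ n, 0 < ρ n := fun n => by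
    simp only [hρdef]
    have : (1 : ℝ) / ((n : ℝ) + 2) ≤ 1 / 2 := by
      apply div_le_div_of_nonneg_left zero_le_one (by norm_num) (by linarith [n.cast_nonneg (α := ℝ)])
    linarith
  have hρ1 : ∀ n, ρ n < 1 := fun n => by
    simp only [hρdef]
    have : 0 < (1 : ℝ) / ((n : ℝ) + 2) := by positivity
    linarith
  have hρlim : Tendsto ρ atTop (𝓝 1) := by
    have h1 : Tendsto (fun n : ℕ => (1 : ℝ) / ((n : ℝ) + 2)) atTop (𝓝 0) :=
      tendsto_const_nhds.div_atTop (tendsto_natCast_atTop_atTop.atTop_add tendsto_const_nhds)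
    have := tendsto_const_nhds (x := (1 : ℝ)).sub h1
    rw [sub_zero] at this
    exact this
  have hGan : AnalyticOnNhd ℂ G (ball 0 1) := hG.analyticOnNhd isOpen_ball
  -- the inequality on each radius
  have hstep : ∀ n, Real.log (‖G 0‖ ^ 2 + ε) ≤
      circleAverage (fun z => Real.log (‖G z‖ ^ 2 + ε)) 0 (ρ n) := by
    intro n
    apply log_normSq_add_le_circleAverage (hρ0 n).ne' _ hε
    apply hGan.mono
    intro z hz
    rw [mem_closedBall, abs_of_pos (hρ0 n)] at hz
    rw [mem_ball]
    exact lt_of_le_of_lt hz (hρ1 n)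
  -- the integrands on `[0, 2π]`
  set F : ℕ → ℝ → ℝ := fun n θ => Real.log (‖G (circleMap 0 (ρ n) θ)‖ ^ 2 + ε) with hFdef
  set Finf : ℝ → ℝ := fun θ => Real.log (‖G (circleMap 0 1 θ)‖ ^ 2 + ε) with hFinfdef
  have hball : ∀ n θ, circleMap 0 (ρ n) θ ∈ ball (0 : ℂ) 1 := by
    intro n θ
    rw [mem_ball, dist_zero_right, norm_circleMap_zero, abs_of_pos (hρ0 n)]
    exact hρ1 n
  -- domination
  set B : ℝ := max |Real.log ε| |Real.log (M ^ 2 + ε)| with hB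
  have hbound : ∀ n θ, |F n θ| ≤ B := by
    intro n θ
    have h1 : ε ≤ ‖G (circleMap 0 (ρ n) θ)‖ ^ 2 + ε := by nlinarith [norm_nonneg (G (circleMap 0 (ρ n) θ))]
    have h2 : ‖G (circleMap 0 (ρ n) θ)‖ ^ 2 + ε ≤ M ^ 2 + ε := by
      have := hM _ (hball n θ)
      nlinarith [norm_nonneg (G (circleMap 0 (ρ n) θ))]
    have hlo := Real.log_le_log hε h1
    have hhi := Real.log_le_log (by linarith) h2
    simp only [hFdef]
    rw [abs_le]
    constructor
    · have : -B ≤ Real.log ε := by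
        have := neg_abs_le (Real.log ε)
        have : |Real.log ε| ≤ B := le_max_left _ _
        linarith
      linarith
    · have : Real.log (M ^ 2 + ε) ≤ B := (le_abs_self _).trans (le_max_right _ _)
      linarith
  -- measurability
  have hmeas : ∀ n, AEStronglyMeasurable (F n) (volume.restrict (Set.Ioc 0 (2 * π))) := by
    intro n
    have hc : Continuous (F n) := by
      simp only [hFdef]
      refine Continuous.log ?_ fun θ => by nlinarith [norm_nonneg (G (circleMap 0 (ρ n) θ))]
      refine (Continuous.pow (Continuous.norm ?_) 2).add continuous_const
      exact hG.continuousOn.comp_continuous (continuous_circleMap 0 (ρ n)) (hball n)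
    exact hc.aestronglyMeasurable
  -- a.e. convergence
  have hae : ∀ᵐ θ ∂(volume.restrict (Set.Ioc 0 (2 * π))),
      Tendsto (fun n => F n θ) atTop (𝓝 (Finf θ)) := by
    have hnull : volume {θ : ℝ | circleMap 0 1 θ ∈ E} = 0 :=
      (countable_circleMap_preimage hE 0 one_ne_zero).measure_zero volume
    have hae' : ∀ᵐ θ ∂(volume : Measure ℝ), circleMap 0 1 θ ∉ E := by
      rw [ae_iff]
      simpa using hnull
    refine ae_restrict_of_ae (hae'.mono fun θ hθ => ?_)
    -- `circleMap 0 (ρ n) θ → circleMap 0 1 θ` within `closedBall 0 1 \ E`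
    have hpt : Tendsto (fun n => circleMap 0 (ρ n) θ) atTop (𝓝 (circleMap 0 1 θ)) := by
      have : Continuous fun r : ℝ => circleMap 0 r θ := by
        unfold circleMap; fun_prop
      exact (this.tendsto 1).comp hρlim
    have hmemW : ∀ᶠ n in atTop, circleMap 0 (ρ n) θ ∈ closedBall (0 : ℂ) 1 \ E := by
      have hEc : IsClosed E := hE.isClosed
      have hopen : IsOpen Eᶜ := hEc.isOpen_compl
      have hev : ∀ᶠ n in atTop, circleMap 0 (ρ n) θ ∈ Eᶜ :=
        hpt (hopen.mem_nhds hθ)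
      filter_upwards [hev] with n hn
      exact ⟨ball_subset_closedBall (hball n θ), hn⟩
    have hW : Tendsto (fun n => circleMap 0 (ρ n) θ) atTop (𝓝[closedBall (0 : ℂ) 1 \ E] (circleMap 0 1 θ)) :=
      tendsto_nhdsWithin_iff.2 ⟨hpt, hmemW⟩
    have hmem1 : circleMap 0 1 θ ∈ closedBall (0 : ℂ) 1 \ E :=
      ⟨by rw [mem_closedBall, dist_zero_right, norm_circleMap_zero, abs_one], hθ⟩
    have hGlim : Tendsto (fun n => G (circleMap 0 (ρ n) θ)) atTop (𝓝 (G (circleMap 0 1 θ))) :=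
      ((hcont _ hmem1).tendsto).comp hW
    simp only [hFdef, hFinfdef]
    apply ((Real.continuousAt_log _).tendsto).comp
    · exact ((hGlim.norm).pow 2).add tendsto_const_nhds
    · nlinarith [norm_nonneg (G (circleMap 0 1 θ))]
  -- dominated convergence for the interval integrals
  have hDCT : Tendsto (fun n => ∫ θ in (0 : ℝ)..2 * π, F n θ) atTop (𝓝 (∫ θ in (0 : ℝ)..2 * π, Finf θ)) := by
    simp only [intervalIntegral.integral_of_le (le_of_lt two_pi_pos)]
    refine tendsto_integral_of_dominated_convergence (fun _ => B) hmeas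
      (integrable_const B) (fun n => Filter.Eventually.of_forall fun θ => ?_) hae
    rw [Real.norm_eq_abs]
    exact hbound n θ
  have hlim : Tendsto (fun n => circleAverage (fun z => Real.log (‖G z‖ ^ 2 + ε)) 0 (ρ n)) atTop
      (𝓝 (circleAverage (fun z => Real.log (‖G z‖ ^ 2 + ε)) 0 1)) := by
    simp only [circleAverage_def, smul_eq_mul]
    exact hDCT.const_mul _
  exact ge_of_tendsto' hlim hstep

/-- **Sub-mean-value inequality with radial boundary values**: `G` holomorphic and bounded on the
open unit disc, with radial limits `G(ρe^{iθ}) → g(θ)` (`ρ ↑ 1`) for a.e. `θ`; then for `ε > 0`,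
`log(‖G 0‖² + ε) ≤ (2π)⁻¹ ∫_0^{2π} log(‖g θ‖² + ε) dθ`. (The form needed when the boundary
correspondence of an explicit conformal map is discontinuous along a branch cut.) [folklore] -/
theorem log_normSq_add_le_average_radialLimit {G : ℂ → ℂ} {g : ℝ → ℂ} {M ε : ℝ}
    (hG : DifferentiableOn ℂ G (ball 0 1)) (hM : ∀ z ∈ ball 0 1, ‖G z‖ ≤ M) (hε : 0 < ε)
    (hrad : ∀ᵐ θ ∂(volume : Measure ℝ),
      Tendsto (fun ρ : ℝ => G (circleMap 0 ρ θ)) (𝓝[<] 1) (𝓝 (g θ))) :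
    Real.log (‖G 0‖ ^ 2 + ε) ≤
      (2 * π)⁻¹ * ∫ θ in (0 : ℝ)..2 * π, Real.log (‖g θ‖ ^ 2 + ε) := by
  -- radii `ρ_n = 1 - 1/(n+2)`
  set ρ : ℕ → ℝ := fun n => 1 - 1 / ((n : ℝ) + 2) with hρdef
  have hρ0 : ∀ n, 0 < ρ n := fun n => by
    simp only [hρdef]
    have : (1 : ℝ) / ((n : ℝ) + 2) ≤ 1 / 2 := by
      apply div_le_div_of_nonneg_left zero_le_one (by norm_num) (by linarith [n.cast_nonneg (α := ℝ)])
    linarith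
  have hρ1 : ∀ n, ρ n < 1 := fun n => by
    simp only [hρdef]
    have : 0 < (1 : ℝ) / ((n : ℝ) + 2) := by positivity
    linarith
  have hρlim : Tendsto ρ atTop (𝓝 1) := by
    have h1 : Tendsto (fun n : ℕ => (1 : ℝ) / ((n : ℝ) + 2)) atTop (𝓝 0) :=
      tendsto_const_nhds.div_atTop (tendsto_natCast_atTop_atTop.atTop_add tendsto_const_nhds)
    have := tendsto_const_nhds (x := (1 : ℝ)).sub h1
    rw [sub_zero] at this
    exact this
  have hρlimW : Tendsto ρ atTop (𝓝[<] 1) :=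
    tendsto_nhdsWithin_iff.2 ⟨hρlim, Filter.Eventually.of_forall fun n => hρ1 n⟩
  have hGan : AnalyticOnNhd ℂ G (ball 0 1) := hG.analyticOnNhd isOpen_ball
  have hstep : ∀ n, Real.log (‖G 0‖ ^ 2 + ε) ≤
      circleAverage (fun z => Real.log (‖G z‖ ^ 2 + ε)) 0 (ρ n) := by
    intro n
    apply log_normSq_add_le_circleAverage (hρ0 n).ne' _ hε
    apply hGan.mono
    intro z hz
    rw [mem_closedBall, abs_of_pos (hρ0 n)] at hz
    rw [mem_ball]
    exact lt_of_le_of_lt hz (hρ1 n)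
  set F : ℕ → ℝ → ℝ := fun n θ => Real.log (‖G (circleMap 0 (ρ n) θ)‖ ^ 2 + ε) with hFdef
  set Finf : ℝ → ℝ := fun θ => Real.log (‖g θ‖ ^ 2 + ε) with hFinfdef
  have hball : ∀ n θ, circleMap 0 (ρ n) θ ∈ ball (0 : ℂ) 1 := by
    intro n θ
    rw [mem_ball, dist_zero_right, norm_circleMap_zero, abs_of_pos (hρ0 n)]
    exact hρ1 n
  have hM0 : 0 ≤ M := (norm_nonneg _).trans (hM 0 (by simp))
  set B : ℝ := max |Real.log ε| |Real.log (M ^ 2 + ε)| with hB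
  have hbound : ∀ n θ, |F n θ| ≤ B := by
    intro n θ
    have h1 : ε ≤ ‖G (circleMap 0 (ρ n) θ)‖ ^ 2 + ε := by nlinarith [norm_nonneg (G (circleMap 0 (ρ n) θ))]
    have h2 : ‖G (circleMap 0 (ρ n) θ)‖ ^ 2 + ε ≤ M ^ 2 + ε := by
      have := hM _ (hball n θ)
      nlinarith [norm_nonneg (G (circleMap 0 (ρ n) θ))]
    have hlo := Real.log_le_log hε h1
    have hhi := Real.log_le_log (by linarith) h2
    simp only [hFdef]
    rw [abs_le]
    constructor
    · have : -B ≤ Real.log ε := by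
        have := neg_abs_le (Real.log ε)
        have : |Real.log ε| ≤ B := le_max_left _ _
        linarith
      linarith
    · have : Real.log (M ^ 2 + ε) ≤ B := (le_abs_self _).trans (le_max_right _ _)
      linarith
  have hmeas : ∀ n, AEStronglyMeasurable (F n) (volume.restrict (Set.Ioc 0 (2 * π))) := by
    intro n
    have hc : Continuous (F n) := by
      simp only [hFdef]
      refine Continuous.log ?_ fun θ => by nlinarith [norm_nonneg (G (circleMap 0 (ρ n) θ))]
      refine (Continuous.pow (Continuous.norm ?_) 2).add continuous_const
      exact hG.continuousOn.comp_continuous (continuous_circleMap 0 (ρ n)) (hball n)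
    exact hc.aestronglyMeasurable
  have hae : ∀ᵐ θ ∂(volume.restrict (Set.Ioc 0 (2 * π))),
      Tendsto (fun n => F n θ) atTop (𝓝 (Finf θ)) := by
    refine ae_restrict_of_ae (hrad.mono fun θ hθ => ?_)
    have hGlim : Tendsto (fun n => G (circleMap 0 (ρ n) θ)) atTop (𝓝 (g θ)) := hθ.comp hρlimW
    simp only [hFdef, hFinfdef]
    apply ((Real.continuousAt_log _).tendsto).comp
    · exact ((hGlim.norm).pow 2).add tendsto_const_nhds
    · nlinarith [norm_nonneg (g θ)]
  have hDCT : Tendsto (fun n => ∫ θ in (0 : ℝ)..2 * π, F n θ) atTop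
      (𝓝 (∫ θ in (0 : ℝ)..2 * π, Finf θ)) := by
    simp only [intervalIntegral.integral_of_le (le_of_lt two_pi_pos)]
    refine tendsto_integral_of_dominated_convergence (fun _ => B) hmeas
      (integrable_const B) (fun n => Filter.Eventually.of_forall fun θ => ?_) hae
    rw [Real.norm_eq_abs]
    exact hbound n θ
  have hlim : Tendsto (fun n => circleAverage (fun z => Real.log (‖G z‖ ^ 2 + ε)) 0 (ρ n)) atTop
      (𝓝 ((2 * π)⁻¹ * ∫ θ in (0 : ℝ)..2 * π, Finf θ)) := by
    simp only [circleAverage_def, smul_eq_mul]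
    exact hDCT.const_mul _
  exact ge_of_tendsto' hlim hstep

end Literature.Analysis.Complex
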